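import Mathlib.Analysis.SpecialFunctions.SmoothTransition
import Literature.Geometry.Lorentzian.TameFamilyFarSurgery
import Literature.Geometry.Lorentzian.TameGenericityLocal
import Summits.FinalStateConjecture.FinalStateConjecture.Theorems.SwallowTheDatumParametricKerrBurialLine
import HarnessLib

/-!
# Route `ExactKerrEnds`, crux `CensorshipAlongKerrEnds` (stmt-FinalStateConjecture-18521), line `Sketch`:
# stub `stub_recedingSelection` — RECEDING SELECTION (bookkeeping)

From a glued two-parameter family `H c R` (`‖c‖ < ε`, `R > R⋆`) over a tame immersed family
`G : ℝ¹ → InitialDataSet (𝓡 3) X` on the end `e` (masses continuous on the parameter domain,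
sections jointly smooth in `((c, R), x)`, `H c R = G c` off `e.far R`, DR-flat members, joint
convergence of `wDist (H c R) (G c)` and of the masses at `(0, ∞)`) and a property `P` of `H c R` on
every compact band `C ∌ 0` of the `ε`-ball beyond a threshold `R₂(C)`, we SELECT the tame immersed
family `F' c := H (φ c) (ρ c)` (`c ≠ 0`), `F' 0 := G 0`: `φ` the radial contraction of `ℝ¹` into the
`ε`-ball (`exists_contDiff_radialContraction`), `ρ c = g (‖c‖⁻²)` a RECEDING RADIUS, `g` a smooth
majorant (locally finite sum of `Real.smoothTransition`s) of the thresholds of the compact bands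
`{1/(N+2) ≤ ‖c‖² ≤ 1}`. Joint smoothness at `c = 0` is local exhaustion
(`AFEnd.exists_nhds_forall_disjoint_far`, the pattern of `ParametricKerrBurial.contMDiff_family_section`)
against `c ↦ G (φ c)`; tameness and immersion transfer from `G ∘ φ` by
`IsTameDataFamily.of_wDist_tendsto_of_forall_eventuallyEq`. Mathlib + the Literature cone only; no
definitions, no named facts. Christodoulou, CQG 16 (1999) A23, p. A24; Bartnik, CPAM 39 (1986) §1.
-/

-- the summit-side namespace `Summit.FinalStateConjecture.FinalStateConjecture.…` (summit = problem)
-- doubles the `FinalStateConjecture` path component by design; `dupNamespace` would flag every decl.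
set_option linter.dupNamespace false

noncomputable section

open scoped Manifold ContDiff Topology ENNReal
open Bundle Filter Set Function Metric TopologicalSpace Literature.Geometry.Lorentzian InitialDataSet
open Summit.FinalStateConjecture.FinalStateConjecture.Theorems.SwallowTheDatum.ParametricKerrBurial
  (SmoothSectionsOn AgreeAt)

namespace Summit.FinalStateConjecture.FinalStateConjecture.Theorems.ExactKerrEnds.CensorshipAlongKerrEnds

/-! ## Real analysis: a smooth majorant, the receding radius, the diagonal mass -/

section Radius

/-- **Smooth majorant of a sequence along the half-lines `[N + 1, ∞)`**: a `C^∞` function `g ≥ B`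
with `a N ≤ g u` for `u ≥ N + 1`, namely `g u = B + ∑ₙ max (a n − B) 0 · smoothTransition (u − n)`
(locally finite sum of smooth non-negative terms, the `N`-th switched on for `u ≥ N + 1`). [folklore] -/
private theorem exists_contDiff_majorant (a : ℕ → ℝ) (B : ℝ) :
    ∃ g : ℝ → ℝ, ContDiff ℝ ∞ g ∧ (∀ u, B ≤ g u) ∧
      ∀ (N : ℕ) (u : ℝ), (N : ℝ) + 1 ≤ u → a N ≤ g u := by
  set T : ℕ → ℝ → ℝ := fun n u ↦ max (a n - B) 0 * Real.smoothTransition (u - n) with hT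
  have hT_nonneg : ∀ n u, 0 ≤ T n u := fun n u ↦
    mul_nonneg (le_max_right _ _) (Real.smoothTransition.nonneg _)
  have hT_smooth : ∀ n, ContDiff ℝ ∞ (T n) := fun n ↦
    contDiff_const.mul (Real.smoothTransition.contDiff.comp (contDiff_id.sub contDiff_const))
  -- on `(-∞, M)` only the terms `n < M` survive
  have hfin : ∀ (M : ℕ) (u : ℝ), u < M → ∀ n ∉ Finset.range M, T n u = 0 := by
    intro M u hu n hn
    have hun : u < n := hu.trans_le (by exact_mod_cast not_lt.1 fun h ↦ hn (Finset.mem_range.2 h))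
    simp only [hT, Real.smoothTransition.zero_of_nonpos (sub_neg.2 hun).le, mul_zero]
  refine ⟨fun u ↦ B + ∑' n, T n u, ?_,
    fun u ↦ le_add_of_nonneg_right (tsum_nonneg fun n ↦ hT_nonneg n u), ?_⟩
  · -- smoothness: locally a finite sum of smooth functions
    refine contDiff_iff_contDiffAt.2 fun u₀ ↦ ?_
    obtain ⟨M, hM⟩ := exists_nat_gt u₀
    have hloc : (fun u ↦ B + ∑' n, T n u) =ᶠ[𝓝 u₀] fun u ↦ B + ∑ n ∈ Finset.range M, T n u := by
      filter_upwards [Iio_mem_nhds hM] with u hu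
      rw [tsum_eq_sum (hfin M u hu)]
    exact ((contDiff_const.add (ContDiff.sum fun n _ ↦ hT_smooth n)).contDiffAt).congr_of_eventuallyEq
      hloc
  · -- the bound on `[N + 1, ∞)`: the `N`-th term alone is `max (a N - B) 0 ≥ a N - B`
    intro N u hu
    obtain ⟨M, hM⟩ := exists_nat_gt u
    have hN : T N u = max (a N - B) 0 := by
      simp only [hT, Real.smoothTransition.one_of_one_le (show (1 : ℝ) ≤ u - N by linarith),
        mul_one]
    have hle : ∑ n ∈ {N}, T n u ≤ ∑' n, T n u :=
      (summable_of_ne_finset_zero (hfin M u hM)).sum_le_tsum {N} fun n _ ↦ hT_nonneg n u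
    rw [Finset.sum_singleton, hN] at hle
    linarith [le_max_left (a N - B) 0]

/-- **Receding radius selection.** If `Q c R` (`c ∈ ℝ¹`) holds on every compact `C ∌ 0` beyond a
threshold `R₂(C)`, then there is `ρ : ℝ¹ → ℝ`, `C^∞` on `{c ≠ 0}`, `> R⋆` off `0`, `→ +∞` at `0`,
with `Q c (ρ c)` for `0 < ‖c‖ ≤ 1`: `ρ c := g (‖c‖⁻²)`, `g` a smooth majorant of
`N ↦ max (R₂(B_N)) N + 1`, `B_N = {1/(N+2) ≤ ‖c‖² ≤ 1} ∋ c` for `N + 1 = ⌊‖c‖⁻²⌋₊`. [folklore] -/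
private theorem exists_recedingRadius {Q : EuclideanSpace ℝ (Fin 1) → ℝ → Prop} (Rstar : ℝ)
    (hQ : ∀ C : Set (EuclideanSpace ℝ (Fin 1)), IsCompact C → (0 : EuclideanSpace ℝ (Fin 1)) ∉ C →
      ∃ R₂ : ℝ, ∀ c ∈ C, ∀ R : ℝ, R₂ < R → Q c R) :
    ∃ ρ : EuclideanSpace ℝ (Fin 1) → ℝ, ContDiffOn ℝ ∞ ρ {c | c ≠ 0} ∧ (∀ c, c ≠ 0 → Rstar < ρ c) ∧
      (∀ b : ℝ, ∀ᶠ c in 𝓝 (0 : EuclideanSpace ℝ (Fin 1)), c ≠ 0 → b < ρ c) ∧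
      ∀ c, c ≠ 0 → ‖c‖ ≤ 1 → Q c (ρ c) := by
  -- compact bands `B N = {1/(N+2) ≤ ‖c‖² ≤ 1}` off `0` and their thresholds `R₂ N`
  set B : ℕ → Set (EuclideanSpace ℝ (Fin 1)) :=
    fun N ↦ {c | 1 / ((N : ℝ) + 2) ≤ ‖c‖ ^ 2 ∧ ‖c‖ ^ 2 ≤ 1} with hB
  have hBc : ∀ N, IsCompact (B N) := fun N ↦
    (isCompact_closedBall (0 : EuclideanSpace ℝ (Fin 1)) 1).of_isClosed_subset
      ((isClosed_le continuous_const (continuous_norm.pow 2)).inter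
        (isClosed_le (continuous_norm.pow 2) continuous_const))
      fun c hc ↦ mem_closedBall_zero_iff.2
        ((pow_le_one_iff_of_nonneg (norm_nonneg c) two_ne_zero).1 hc.2)
  have hB0 : ∀ N, (0 : EuclideanSpace ℝ (Fin 1)) ∉ B N := fun N hN ↦
    absurd hN.1 (not_le.2 (by rw [norm_zero, zero_pow two_ne_zero]; positivity))
  choose R₂ hR₂ using fun N ↦ hQ (B N) (hBc N) (hB0 N)
  -- smooth majorant in the variable `u = ‖c‖⁻²`: `g u ≥ max (R₂ N) N + 1` for `u ≥ N + 1`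
  obtain ⟨g, hg, hgB, hga⟩ := exists_contDiff_majorant (fun N ↦ max (R₂ N) N + 1) (Rstar + 1)
  refine ⟨fun c ↦ g ((‖c‖ ^ 2)⁻¹),
    hg.comp_contDiffOn ((contDiff_norm_sq ℝ).contDiffOn.inv fun c hc ↦
      pow_ne_zero 2 (norm_ne_zero_iff.2 hc)),
    fun c _ ↦ lt_of_lt_of_le (lt_add_one Rstar) (hgB _), fun b ↦ ?_, fun c hc hc1 ↦ ?_⟩
  · -- `→ +∞` at `0`: `‖c‖ < (N+1)⁻¹ ≤ 1` gives `‖c‖⁻² > N + 1`, so `ρ c ≥ max (R₂ N) N + 1 > b`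
    obtain ⟨N, hN⟩ := exists_nat_ge b
    have hδ : (0 : ℝ) < ((N : ℝ) + 1)⁻¹ := by positivity
    filter_upwards [ball_mem_nhds (0 : EuclideanSpace ℝ (Fin 1)) hδ] with c hc hc0
    rw [mem_ball_zero_iff] at hc
    have h1 : ‖c‖ ^ 2 < ((N : ℝ) + 1)⁻¹ :=
      (pow_le_of_le_one (norm_nonneg c)
        (hc.le.trans (inv_le_one_of_one_le₀ (by linarith))) two_ne_zero).trans_lt hc
    have h2 : (N : ℝ) + 1 < (‖c‖ ^ 2)⁻¹ := by
      simpa only [inv_inv] using (inv_lt_inv₀ hδ (by positivity)).2 h1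
    have h3 : max (R₂ N) N + 1 ≤ g ((‖c‖ ^ 2)⁻¹) := hga N _ h2.le
    exact lt_of_le_of_lt hN (by linarith [le_max_right (R₂ N) (N : ℝ)])
  · -- `0 < ‖c‖ ≤ 1`: `c ∈ B N` with `N + 1 = ⌊‖c‖⁻²⌋₊`, and `ρ c ≥ max (R₂ N) N + 1 > R₂ N`
    show Q c (g ((‖c‖ ^ 2)⁻¹))
    set u : ℝ := (‖c‖ ^ 2)⁻¹ with hu
    have hcpos : 0 < ‖c‖ ^ 2 := by positivity
    have hc2 : ‖c‖ ^ 2 ≤ 1 := pow_le_one₀ (norm_nonneg c) hc1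
    have hK1 : 1 ≤ ⌊u⌋₊ := (Nat.one_le_floor_iff u).2 ((one_le_inv₀ hcpos).2 hc2)
    have hKu : (⌊u⌋₊ : ℝ) ≤ u := Nat.floor_le (inv_pos.2 hcpos).le
    have huK : u < ⌊u⌋₊ + 1 := Nat.lt_floor_add_one u
    have hNK : ((⌊u⌋₊ - 1 : ℕ) : ℝ) = ⌊u⌋₊ - 1 := by rw [Nat.cast_sub hK1, Nat.cast_one]
    have hmem : c ∈ B (⌊u⌋₊ - 1) := by
      refine ⟨?_, hc2⟩
      have hlt := (inv_lt_inv₀ (by positivity) (by positivity)).2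
        (show u < ((⌊u⌋₊ - 1 : ℕ) : ℝ) + 2 by linarith)
      rw [hu, inv_inv, ← one_div] at hlt
      exact hlt.le
    have hle : max (R₂ (⌊u⌋₊ - 1)) (⌊u⌋₊ - 1 : ℕ) + 1 ≤ g u := hga _ u (by linarith)
    exact hR₂ _ c hmem (g u) (by linarith [le_max_left (R₂ (⌊u⌋₊ - 1)) ((⌊u⌋₊ - 1 : ℕ) : ℝ)])

/-- **The diagonal mass is continuous**: `c ↦ m (φ c) (ρ c)` (`c ≠ 0`), `0 ↦ Mf 0` is continuous
— off `0` by composition on the open parameter domain, at `0` because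
`|m (φ c) (ρ c) − Mf 0| ≤ |m (φ c) (ρ c) − Mf (φ c)| + |Mf (φ c) − Mf 0|`. [folklore] -/
private theorem continuous_diagonalMass
    {φ : EuclideanSpace ℝ (Fin 1) → EuclideanSpace ℝ (Fin 1)} {ρ : EuclideanSpace ℝ (Fin 1) → ℝ}
    {m : EuclideanSpace ℝ (Fin 1) → ℝ → ℝ} {Mf : EuclideanSpace ℝ (Fin 1) → ℝ} {ε Rstar : ℝ}
    (hφ : Continuous φ) (hφ0 : φ 0 = 0) (hφε : ∀ c, ‖φ c‖ < ε) (hMf : Continuous Mf)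
    (hm : ContinuousOn (fun q : EuclideanSpace ℝ (Fin 1) × ℝ ↦ m q.1 q.2)
      {q | ‖q.1‖ < ε ∧ Rstar < q.2})
    (hρ : ContinuousOn ρ {c | c ≠ 0}) (hρ' : ∀ c, c ≠ 0 → Rstar < ρ c)
    (hρ0 : ∀ b : ℝ, ∀ᶠ c in 𝓝 (0 : EuclideanSpace ℝ (Fin 1)), c ≠ 0 → b < ρ c)
    (hjoint : ∀ η : ℝ, 0 < η → ∃ ε₁ R₁ : ℝ, 0 < ε₁ ∧
      ∀ (c : EuclideanSpace ℝ (Fin 1)) (R : ℝ), ‖c‖ < ε₁ → R₁ < R → |m c R - Mf c| < η) :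
    Continuous (fun c ↦ if c = 0 then Mf 0 else m (φ c) (ρ c)) := by
  refine continuous_iff_continuousAt.2 fun c₀ ↦ ?_
  by_cases hc₀ : c₀ = 0
  · subst hc₀
    have key : Tendsto (fun c ↦ if c = 0 then Mf 0 else m (φ c) (ρ c))
        (𝓝 (0 : EuclideanSpace ℝ (Fin 1))) (𝓝 (Mf 0)) := by
      refine Metric.tendsto_nhds.2 fun η hη ↦ ?_
      obtain ⟨ε₁, R₁, hε₁, hclose⟩ := hjoint (η / 2) (half_pos hη)
      have hφt : Tendsto φ (𝓝 0) (𝓝 0) := by simpa only [hφ0] using hφ.tendsto 0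
      have hMt : Tendsto (fun c ↦ Mf (φ c)) (𝓝 0) (𝓝 (Mf 0)) := by
        simpa only [Function.comp_def, hφ0] using (hMf.comp hφ).tendsto 0
      filter_upwards [hφt.eventually (ball_mem_nhds (0 : EuclideanSpace ℝ (Fin 1)) hε₁),
        Metric.tendsto_nhds.1 hMt (η / 2) (half_pos hη), hρ0 R₁] with c h1 h2 h3
      by_cases hc : c = 0
      · subst hc
        simpa using hη
      · rw [if_neg hc]
        have h4 : dist (m (φ c) (ρ c)) (Mf (φ c)) < η / 2 := by
          rw [Real.dist_eq]
          exact hclose (φ c) (ρ c) (mem_ball_zero_iff.1 h1) (h3 hc)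
        calc dist (m (φ c) (ρ c)) (Mf 0)
            ≤ dist (m (φ c) (ρ c)) (Mf (φ c)) + dist (Mf (φ c)) (Mf 0) := dist_triangle _ _ _
          _ < η / 2 + η / 2 := add_lt_add h4 h2
          _ = η := add_halves η
    simpa [ContinuousAt] using key
  · -- off `0`: composition of `m` (continuous on the open parameter domain) with `c ↦ (φ c, ρ c)`
    have hopen : IsOpen {q : EuclideanSpace ℝ (Fin 1) × ℝ | ‖q.1‖ < ε ∧ Rstar < q.2} :=
      (isOpen_lt (continuous_norm.comp continuous_fst) continuous_const).inter
        (isOpen_lt continuous_const continuous_snd)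
    have h3 : ContinuousAt (fun c ↦ m (φ c) (ρ c)) c₀ :=
      ContinuousAt.comp (f := fun c ↦ (φ c, ρ c)) (x := c₀)
        (hm.continuousAt (hopen.mem_nhds ⟨hφε c₀, hρ' c₀ hc₀⟩))
        (hφ.continuousAt.prodMk (hρ.continuousAt (isOpen_ne.mem_nhds hc₀)))
    refine h3.congr ?_
    filter_upwards [isOpen_ne.mem_nhds hc₀] with c hc
    exact (if_neg hc).symm

end Radius

/-! ## Differential topology: the diagonal of a glued family -/

section Diagonal

variable {X : Type} [TopologicalSpace X] [ChartedSpace E3 X] [IsManifold (𝓡 3) ∞ X]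

-- adapted from `SwallowTheDatum.isSmoothDataFamily_of_eventuallyEq` (`Theorems/SwallowTheDatum
-- ParametricKerrBurialFamily.lean`): a smooth comparison FAMILY instead of the constant one.
/-- **Eventual agreement with a smooth family at `c = 0` ⇒ smooth family**: sections jointly `C^∞`
on `{c ≠ 0} × X` and agreeing near every `(0, x₀)` with those of a smooth family `E`. [folklore] -/
private theorem isSmoothDataFamily_of_eventually_agree
    {F E : EuclideanSpace ℝ (Fin 1) → InitialDataSet (𝓡 3) X} (hE : IsSmoothDataFamily 1 E)
    (hF : SmoothSectionsOn 𝓘(ℝ, EuclideanSpace ℝ (Fin 1)) F {p | p.1 ≠ 0})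
    (hloc : ∀ x₀ : X, ∀ᶠ p in 𝓝 ((0 : EuclideanSpace ℝ (Fin 1)), x₀), AgreeAt (F p.1) (E p.1) p.2) :
    IsSmoothDataFamily 1 F := by
  have hopen : IsOpen {p : EuclideanSpace ℝ (Fin 1) × X | p.1 ≠ 0} :=
    isOpen_ne.preimage continuous_fst
  refine ⟨fun p ↦ ?_, fun p ↦ ?_⟩
  · by_cases hp : p.1 = 0
    · have hp' : p = (0, p.2) := Prod.ext hp rfl
      refine (hE.1 p).congr_of_eventuallyEq ?_
      rw [hp']
      filter_upwards [hloc p.2] with q hq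
      simp only [hq.1]
    · exact hF.1.contMDiffAt (hopen.mem_nhds hp)
  · by_cases hp : p.1 = 0
    · have hp' : p = (0, p.2) := Prod.ext hp rfl
      refine (hE.2 p).congr_of_eventuallyEq ?_
      rw [hp']
      filter_upwards [hloc p.2] with q hq
      simp only [hq.2]
    · exact hF.2.contMDiffAt (hopen.mem_nhds hp)

-- the local-exhaustion pattern of `ParametricKerrBurial.contMDiff_family_section`
-- (`Theorems/SwallowTheDatumParametricKerrBurialLine.lean`), comparison family `c ↦ G (φ c)`.
/-- **The diagonal of a glued family is a smooth family**: `F' c := H (φ c) (ρ c)` (`c ≠ 0`),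
`F' 0 := G 0` has jointly smooth sections, agreeing at every `x` with those of `G (φ c)` for `c` near
`0` — off `c = 0` by composition with `(c, x) ↦ ((φ c, ρ c), x)`, at `c = 0` because `x` has a
neighbourhood missing `e.far R` for all large `R` (`AFEnd.exists_nhds_forall_disjoint_far`) and
`ρ → +∞`. [folklore] -/
private theorem isSmoothDataFamily_diagonal (e : AFEnd X)
    {G : EuclideanSpace ℝ (Fin 1) → InitialDataSet (𝓡 3) X}
    {H : EuclideanSpace ℝ (Fin 1) → ℝ → InitialDataSet (𝓡 3) X}
    {φ : EuclideanSpace ℝ (Fin 1) → EuclideanSpace ℝ (Fin 1)} {ρ : EuclideanSpace ℝ (Fin 1) → ℝ}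
    {ε Rstar : ℝ} (hG : IsSmoothDataFamily 1 G) (hφ : ContDiff ℝ ∞ φ) (hφ0 : φ 0 = 0)
    (hφε : ∀ c, ‖φ c‖ < ε)
    (hH : SmoothSectionsOn (𝓘(ℝ, EuclideanSpace ℝ (Fin 1)).prod 𝓘(ℝ, ℝ))
      (fun q : EuclideanSpace ℝ (Fin 1) × ℝ ↦ H q.1 q.2)
      {p : (EuclideanSpace ℝ (Fin 1) × ℝ) × X | ‖p.1.1‖ < ε ∧ Rstar < p.1.2})
    (hHG : ∀ (c : EuclideanSpace ℝ (Fin 1)) (R : ℝ), ‖c‖ < ε → Rstar < R →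
      ∀ x ∉ e.far R, AgreeAt (H c R) (G c) x)
    (hρ : ContDiffOn ℝ ∞ ρ {c | c ≠ 0}) (hρ' : ∀ c, c ≠ 0 → Rstar < ρ c)
    (hρ0 : ∀ b : ℝ, ∀ᶠ c in 𝓝 (0 : EuclideanSpace ℝ (Fin 1)), c ≠ 0 → b < ρ c) :
    IsSmoothDataFamily 1 (fun c ↦ if c = 0 then G 0 else H (φ c) (ρ c)) ∧
      ∀ x : X, ∀ᶠ c in 𝓝 (0 : EuclideanSpace ℝ (Fin 1)),
        AgreeAt (if c = 0 then G 0 else H (φ c) (ρ c)) (G (φ c)) x := by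
  -- eventual agreement with the comparison family `c ↦ G (φ c)` near every `(0, x₀)`
  have hloc : ∀ x₀ : X, ∀ᶠ p in 𝓝 ((0 : EuclideanSpace ℝ (Fin 1)), x₀),
      AgreeAt (if p.1 = 0 then G 0 else H (φ p.1) (ρ p.1)) (G (φ p.1)) p.2 := by
    intro x₀
    obtain ⟨V, hV, R₀, hR₀⟩ := e.exists_nhds_forall_disjoint_far x₀
    have h2 : ∀ᶠ p in 𝓝 ((0 : EuclideanSpace ℝ (Fin 1)), x₀),
        (p.1 ≠ 0 → R₀ < ρ p.1) ∧ p.2 ∈ V := by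
      rw [nhds_prod_eq]
      exact (hρ0 R₀).prod_mk hV
    filter_upwards [h2] with ⟨c, x⟩ hp
    by_cases hc : c = 0
    · subst hc
      simp only [if_true, hφ0]
      exact ⟨rfl, rfl⟩
    · simp only [if_neg hc]
      exact hHG (φ c) (ρ c) (hφε c) (hρ' c hc) x
        fun hx ↦ Set.disjoint_left.1 (hR₀ (ρ c) (hp.1 hc).le) hx hp.2
  refine ⟨?_, fun x ↦
    ((continuous_id.prodMk continuous_const).tendsto (0 : EuclideanSpace ℝ (Fin 1))).eventually
      (hloc x)⟩
  -- smoothness: off `0` by composition with the parameter map, at `0` by `hloc`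
  have hπ : ContMDiffOn (𝓘(ℝ, EuclideanSpace ℝ (Fin 1)).prod (𝓡 3))
      ((𝓘(ℝ, EuclideanSpace ℝ (Fin 1)).prod 𝓘(ℝ, ℝ)).prod (𝓡 3)) ∞
      (fun q : EuclideanSpace ℝ (Fin 1) × X ↦ ((φ q.1, ρ q.1), q.2)) {q | q.1 ≠ 0} :=
    ((hφ.contMDiff.comp_contMDiffOn contMDiffOn_fst).prodMk
      (hρ.contMDiffOn.comp contMDiffOn_fst fun _ hq ↦ hq)).prodMk contMDiffOn_snd
  have hmaps : {q : EuclideanSpace ℝ (Fin 1) × X | q.1 ≠ 0} ⊆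
      (fun q : EuclideanSpace ℝ (Fin 1) × X ↦ ((φ q.1, ρ q.1), q.2)) ⁻¹'
        {p : (EuclideanSpace ℝ (Fin 1) × ℝ) × X | ‖p.1.1‖ < ε ∧ Rstar < p.1.2} :=
    fun q hq ↦ ⟨hφε q.1, hρ' q.1 hq⟩
  refine isSmoothDataFamily_of_eventually_agree (hG.comp_contDiff hφ) ⟨?_, ?_⟩ hloc
  · exact (hH.1.comp hπ hmaps).congr fun q hq ↦ by
      simp only [Function.comp_apply, if_neg (show q.1 ≠ 0 from hq)]
  · exact (hH.2.comp hπ hmaps).congr fun q hq ↦ by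
      simp only [Function.comp_apply, if_neg (show q.1 ≠ 0 from hq)]

/-- **The diagonal family is tame, immersed, through `G 0`, with `P` on the punctured unit window**:
compare `F' c := H (φ c) (ρ c)` (`c ≠ 0`), `F' 0 := G 0` with the tame immersed family `G ∘ φ`
(`IsTameDataFamily.comp_contDiff`, `IsImmersedAtZero.comp_of_injective_fderiv`) through
`IsTameDataFamily.of_wDist_tendsto_of_forall_eventuallyEq`: joint smoothness and pointwise eventual
agreement (`isSmoothDataFamily_diagonal`), continuous diagonal mass (`continuous_diagonalMass`),
DR-flat members, `wDist (F' c) (G (φ c)) → 0` by the joint convergence. [cite: Christodoulou1999, p. A24] -/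
private theorem exists_diagonalFamily (e : AFEnd X) (P : InitialDataSet (𝓡 3) X → Prop)
    {G : EuclideanSpace ℝ (Fin 1) → InitialDataSet (𝓡 3) X} {Mf : EuclideanSpace ℝ (Fin 1) → ℝ}
    {ε Rstar : ℝ} {m : EuclideanSpace ℝ (Fin 1) → ℝ → ℝ}
    {H : EuclideanSpace ℝ (Fin 1) → ℝ → InitialDataSet (𝓡 3) X}
    {φ : EuclideanSpace ℝ (Fin 1) → EuclideanSpace ℝ (Fin 1)} {ρ : EuclideanSpace ℝ (Fin 1) → ℝ}
    (hG : IsTameDataFamily e 1 G) (himm : IsImmersedAtZero 1 G) (hMf : Continuous Mf)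
    (hGDR : ∀ c, e.IsStronglyAsymptoticallyFlatDR (G c) (Mf c))
    (hm : ContinuousOn (fun q : EuclideanSpace ℝ (Fin 1) × ℝ ↦ m q.1 q.2)
      {q | ‖q.1‖ < ε ∧ Rstar < q.2})
    (hH : SmoothSectionsOn (𝓘(ℝ, EuclideanSpace ℝ (Fin 1)).prod 𝓘(ℝ, ℝ))
      (fun q : EuclideanSpace ℝ (Fin 1) × ℝ ↦ H q.1 q.2)
      {p : (EuclideanSpace ℝ (Fin 1) × ℝ) × X | ‖p.1.1‖ < ε ∧ Rstar < p.1.2})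
    (hHG : ∀ (c : EuclideanSpace ℝ (Fin 1)) (R : ℝ), ‖c‖ < ε → Rstar < R →
      (∀ x ∉ e.far R, AgreeAt (H c R) (G c) x) ∧ e.IsStronglyAsymptoticallyFlatDR (H c R) (m c R))
    (hjoint : ∀ η : ℝ, 0 < η → ∃ ε₁ R₁ : ℝ, 0 < ε₁ ∧ ε₁ ≤ ε ∧ Rstar ≤ R₁ ∧
      ∀ (c : EuclideanSpace ℝ (Fin 1)) (R : ℝ), ‖c‖ < ε₁ → R₁ < R →
        e.wDist (H c R) (G c) < ENNReal.ofReal η ∧ |m c R - Mf c| < η)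
    (hφ : ContDiff ℝ ∞ φ) (hφ0 : φ 0 = 0) (hφε : ∀ c, ‖φ c‖ < ε)
    (hdφ : Injective (fderiv ℝ φ 0))
    (hρ : ContDiffOn ℝ ∞ ρ {c | c ≠ 0}) (hρ' : ∀ c, c ≠ 0 → Rstar < ρ c)
    (hρ0 : ∀ b : ℝ, ∀ᶠ c in 𝓝 (0 : EuclideanSpace ℝ (Fin 1)), c ≠ 0 → b < ρ c)
    (hP : ∀ c, c ≠ 0 → ‖c‖ ≤ 1 → P (H (φ c) (ρ c))) :
    ∃ F' : EuclideanSpace ℝ (Fin 1) → InitialDataSet (𝓡 3) X,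
      IsTameDataFamily e 1 F' ∧ IsImmersedAtZero 1 F' ∧ F' 0 = G 0 ∧
        ∃ ε' > (0 : ℝ), ∀ c, c ≠ 0 → ‖c‖ < ε' → P (F' c) := by
  obtain ⟨hsmooth, hagree⟩ := isSmoothDataFamily_diagonal e hG.1 hφ hφ0 hφε hH
    (fun c R hc hR ↦ (hHG c R hc hR).1) hρ hρ' hρ0
  have hφt : Tendsto φ (𝓝 0) (𝓝 0) := by simpa only [hφ0] using hφ.continuous.tendsto 0
  -- continuous diagonal mass (the mass half of the joint convergence)
  have hM' : Continuous (fun c ↦ if c = 0 then Mf 0 else m (φ c) (ρ c)) := by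
    refine continuous_diagonalMass hφ.continuous hφ0 hφε hMf hm hρ.continuousOn hρ' hρ0
      fun η hη ↦ ?_
    obtain ⟨ε₁, R₁, hε₁, -, -, h⟩ := hjoint η hη
    exact ⟨ε₁, R₁, hε₁, fun c R hc hR ↦ (h c R hc hR).2⟩
  -- DR-flat members
  have hDR : ∀ c, e.IsStronglyAsymptoticallyFlatDR (if c = 0 then G 0 else H (φ c) (ρ c))
      (if c = 0 then Mf 0 else m (φ c) (ρ c)) := by
    intro c
    by_cases hc : c = 0
    · subst hc
      simpa using hGDR 0
    · simpa only [if_neg hc] using (hHG (φ c) (ρ c) (hφε c) (hρ' c hc)).2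
  -- `wDist (F' c) (G (φ c)) → 0` (the `wDist` half of the joint convergence)
  have hw : Tendsto (fun c ↦ e.wDist (if c = 0 then G 0 else H (φ c) (ρ c)) (G (φ c)))
      (𝓝 (0 : EuclideanSpace ℝ (Fin 1))) (𝓝 0) := by
    refine ENNReal.tendsto_nhds_zero.2 fun δ hδ ↦ ?_
    rcases eq_or_ne δ ⊤ with hδtop | hδtop
    · exact Eventually.of_forall fun c ↦ hδtop ▸ le_top
    obtain ⟨ε₁, R₁, hε₁, -, -, hclose⟩ := hjoint δ.toReal (ENNReal.toReal_pos hδ.ne' hδtop)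
    filter_upwards [hφt.eventually (ball_mem_nhds (0 : EuclideanSpace ℝ (Fin 1)) hε₁), hρ0 R₁]
      with c h1 h3
    by_cases hc : c = 0
    · subst hc
      simp [hφ0, AFEnd.wDist_self]
    · have h4 := (hclose (φ c) (ρ c) (mem_ball_zero_iff.1 h1) (h3 hc)).1
      rw [ENNReal.ofReal_toReal hδtop] at h4
      simpa only [if_neg hc] using h4.le
  have hT := IsTameDataFamily.of_wDist_tendsto_of_forall_eventuallyEq
    (F := fun c ↦ G (φ c)) (F' := fun c ↦ if c = 0 then G 0 else H (φ c) (ρ c))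
    (hG.comp_contDiff hφ hφ0)
    (himm.comp_of_injective_fderiv hφ0 (hφ.differentiable (by simp) 0) hdφ) hsmooth
    (by simp [hφ0]) hM' hDR hw hagree
  refine ⟨fun c ↦ if c = 0 then G 0 else H (φ c) (ρ c), hT.1, hT.2, if_pos rfl, 1, one_pos,
    fun c hc hc1 ↦ ?_⟩
  simpa only [if_neg hc] using hP c hc hc1.le

end Diagonal

/-! ## The stub -/

/-- **Stub `stub_recedingSelection` — RECEDING SELECTION** (registered stub of the line `Sketch` of
the crux `CensorshipAlongKerrEnds`, stmt-FinalStateConjecture-18521; the skeleton's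
`RecedingSelection` expanded). From a glued two-parameter family `H c R` over a tame IMMERSED family
`G` on the end `e` (masses continuous on the parameter domain, jointly smooth sections, agreement
with `G c` off `e.far R`, DR-flat members; joint convergence of `wDist (H c R) (G c)` and of the
masses at `(0, ∞)`) and a property `P` holding for `H c R` on compact bands `C ∌ 0` of the `ε`-ball
eventually in `R`, a tame immersed one-parameter family `F'` through `G 0` is selected whose members
with `0 < ‖c‖ < 1` have `P`: `F' c := H (φ c) (ρ c)`, `F' 0 := G 0`, `φ` the radial contraction of
`ℝ¹` into the `ε`-ball (`exists_contDiff_radialContraction`), `ρ` a receding radius dominating the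
band thresholds (`exists_recedingRadius`); tame and immersed by `exists_diagonalFamily`.
Christodoulou, CQG 16 (1999) A23, p. A24. [cite: Christodoulou1999, p. A24] -/
theorem stub_recedingSelection : ∀ (X : Type) [TopologicalSpace X] [ChartedSpace Literature.Geometry.Lorentzian.E3 X] [IsManifold (𝓡 3) ((⊤ : ℕ∞) : WithTop ℕ∞) X] [T2Space X] [SecondCountableTopology X] [ConnectedSpace X], ∀ (P : Literature.Geometry.Lorentzian.InitialDataSet (𝓡 3) X → Prop) (e : Literature.Geometry.Lorentzian.AFEnd X) (G : EuclideanSpace ℝ (Fin 1) → Literature.Geometry.Lorentzian.InitialDataSet (𝓡 3) X) (Mf : EuclideanSpace ℝ (Fin 1) → ℝ) (ε Rstar : ℝ) (m : EuclideanSpace ℝ (Fin 1) → ℝ → ℝ) (H : EuclideanSpace ℝ (Fin 1) → ℝ → Literature.Geometry.Lorentzian.InitialDataSet (𝓡 3) X), Literature.Geometry.Lorentzian.InitialDataSet.IsTameDataFamily e 1 G → Literature.Geometry.Lorentzian.InitialDataSet.IsImmersedAtZero 1 G → Continuous Mf → (∀ c, e.IsStronglyAsymptoticallyFlatDR (G c)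 (Mf c)) → 0 < ε → e.R < Rstar → (ContinuousOn (fun q : EuclideanSpace ℝ (Fin 1) × ℝ ↦ m q.1 q.2) {q | ‖q.1‖ < ε ∧ Rstar < q.2} ∧ Summit.FinalStateConjecture.FinalStateConjecture.Theorems.SwallowTheDatum.ParametricKerrBurial.SmoothSectionsOn (𝓘(ℝ, EuclideanSpace ℝ (Fin 1)).prod 𝓘(ℝ, ℝ)) (fun q : EuclideanSpace ℝ (Fin 1) × ℝ ↦ H q.1 q.2) {p : (EuclideanSpace ℝ (Fin 1) × ℝ) × X | ‖p.1.1‖ < ε ∧ Rstar < p.1.2} ∧ ∀ (c : EuclideanSpace ℝ (Fin 1)) (R : ℝ), ‖c‖ < ε → Rstar < R → (∀ x ∉ e.far R, Summit.FinalStateConjecture.FinalStateConjecture.Theorems.SwallowTheDatum.ParametricKerrBurial.AgreeAt (H c R) (G c) x) ∧ e.IsStronglyAsymptoticallyFlatDR (H c R) (m c R)) → (∀ η : ℝ, 0 < η → ∃ ε₁ R₁ : ℝ, 0 < ε₁ ∧ ε₁ ≤ ε ∧ Rstar ≤ R₁ ∧ ∀ (c : EuclideanSpace ℝ (Fin 1))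 (R : ℝ), ‖c‖ < ε₁ → R₁ < R → e.wDist (H c R) (G c) < ENNReal.ofReal η ∧ |m c R - Mf c| < η) → (∀ C : Set (EuclideanSpace ℝ (Fin 1)), IsCompact C → (0 : EuclideanSpace ℝ (Fin 1)) ∉ C → C ⊆ Metric.ball (0 : EuclideanSpace ℝ (Fin 1)) ε → ∃ R₂ : ℝ, Rstar ≤ R₂ ∧ ∀ c ∈ C, ∀ R : ℝ, R₂ < R → P (H c R)) → ∃ F' : EuclideanSpace ℝ (Fin 1) → Literature.Geometry.Lorentzian.InitialDataSet (𝓡 3) X, Literature.Geometry.Lorentzian.InitialDataSet.IsTameDataFamily e 1 F' ∧ Literature.Geometry.Lorentzian.InitialDataSet.IsImmersedAtZero 1 F' ∧ F' 0 = G 0 ∧ ∃ ε' > (0 : ℝ), ∀ c, c ≠ 0 → ‖c‖ < ε' → P (F' c) := by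
  intro X _ _ _ _ _ _ P e G Mf ε Rstar m H hG himm hMf hGDR hε _ hstr hjoint hbands
  obtain ⟨hm, hH, hHG⟩ := hstr
  -- radial contraction of the parameter line into the `ε`-ball
  obtain ⟨φ, hφ, -, hφ0, hφε, hφne, hdφ⟩ :=
    exists_contDiff_radialContraction (V := EuclideanSpace ℝ (Fin 1)) hε
  have hdinj : Injective (fderiv ℝ φ 0) := by
    rw [hdφ]
    intro v w h
    simpa [hε.ne'] using h
  -- band thresholds transported along `φ`: a compact `C ∌ 0` maps to the compact `φ '' C ∌ 0`
  -- inside the `ε`-ball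
  have hQ : ∀ C : Set (EuclideanSpace ℝ (Fin 1)), IsCompact C → (0 : EuclideanSpace ℝ (Fin 1)) ∉ C →
      ∃ R₂ : ℝ, ∀ c ∈ C, ∀ R : ℝ, R₂ < R → P (H (φ c) R) := by
    intro C hC h0
    obtain ⟨R₂, -, hR₂⟩ := hbands (φ '' C) (hC.image hφ.continuous)
      (fun ⟨c, hc, hc0⟩ ↦ h0 (hφne c hc0 ▸ hc)) fun _ ⟨c, _, hc⟩ ↦ hc ▸ mem_ball_zero_iff.2 (hφε c)
    exact ⟨R₂, fun c hc R hR ↦ hR₂ (φ c) ⟨c, hc, rfl⟩ R hR⟩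
  -- the receding radius, and the diagonal family
  obtain ⟨ρ, hρ, hρ', hρ0, hPρ⟩ := exists_recedingRadius (Q := fun c R ↦ P (H (φ c) R)) Rstar hQ
  exact exists_diagonalFamily e P hG himm hMf hGDR hm hH hHG hjoint hφ hφ0 hφε hdinj hρ hρ' hρ0 hPρ

end Summit.FinalStateConjecture.FinalStateConjecture.Theorems.ExactKerrEnds.CensorshipAlongKerrEnds

end
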